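import Summits.QuantumFields.YangMills.Theorems.SwapTwistDeficitPeriodicRingFloorCommBox
import Summits.QuantumFields.YangMills.Theorems.SwapTwistDeficitPeriodicRingFloorSharp
import HarnessLib

/-!
# The σ-TWISTED leader volume from a THREE-LETTER volume: `c·t⁴ ≤ Haar³{pairwise ‖D_μD_ν − D_νD_μ‖_F ≤ t}` ⟹ `(c/34/5⁷)·s⁷ ≤ Haar⁴{σ-twisted nearly commuting at radius s}`
# (brick (α2-vi) of LEAD ym-line-sfw-p2 g93's fixed-`L` programme for `TT.twistTrace L β (2L)`: the adapter between seat w2 g54's three-letter floor (α1) and the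
# hypothesis of ✓`swap_twistTrace_floor_of_leaderVolume`; free-hands support of item stmt-QuantumFields-24197 `SwapVirialDeficit.SwapGluedStiffness`)

The σ-twisted flat condition on the four leaders `(C₀, C₁, C₂, c)` of the σ-glued ring — `[C_μ, C_ν] = 1`, `cC₁c⁻¹ = C₀`, `cC₀c⁻¹ = C₁`, `[c, C₂] = 1` — SLAVES the
letter `C₁ = c⁻¹C₀c` to the commuting triple `(C₀, C₂, c)`.  Quantitatively:

* §1 `frobNorm_comm_le_of_near`, ★ `swapComm_of_slaved` — if `C₀, C₂, c` pairwise commute up to `r` and `‖(c⁻¹C₀c)⁻¹C₁ − 1‖_F ≤ r`, the quadruple is σ-twisted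
  nearly commuting at radius `5r`;
* §2 ★★ `swapCommVolume_of_threeLetterVolume` — the set of such quadruples is the preimage of `B_r × {nearly commuting triples}` under the product-Haar
  preserving map `C ↦ ((c⁻¹C₀c)⁻¹C₁, (C₀, C₂, c))` (`piFinSuccAbove` at the index `1` and a skew translation), so a three-letter volume `≥ c·r⁴` gives the
  σ-twisted leader volume `≥ (r³/34)·c·r⁴` at radius `5r` (✓`pow_three_div_le_ballVol`).

HONEST FRAMING: finite-dimensional Haar bookkeeping; the three-letter volume itself (the swap-central cone of commuting triples, `≍ t⁴`, no logarithm) is NOT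
proved here (seat w2 g54's (α1)); no floor ∕ ceiling, crux, rung or summit is proved; the Yang–Mills mass gap is NOT proved; no summit is proved by a line.
THEOREMS ONLY (0 `def`, 0 `sorry`), standard axioms.  Width seat ym-line-sfw-p2-w3 g61 (cell ym-idea-1, free hands), `--supports stmt-QuantumFields-24197`.
References: [cite: Luscher1983, §2]; [cite: GonzalezarroyoAltes1988]; [cite: Chatterjee2016, Lemma 9.3].
-/

set_option autoImplicit false

noncomputable section

open MeasureTheory
open scoped BigOperators ENNReal
open Literature.MathematicalPhysics.QuantumFieldTheory hiding SU2
open Literature.MathematicalPhysics.QuantumLattice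

namespace Summit.QuantumFields.YangMills.Theorems.SwapVirialDeficit.SwapRing

open Summit.QuantumFields.YangMills.Theorems.FemtoTransferGap
open Summit.QuantumFields.YangMills.Theorems.FemtoTransferGap.TT
open Summit.QuantumFields.YangMills.Theorems.SwapTwistDeficit.PeriodicRingFloor

/-! ## §1 Algebra: a slaved letter `C₁ = (c⁻¹C₀c)·e` turns three nearly commuting letters into a σ-twisted nearly commuting quadruple -/

/-- `‖A·X − X·A‖_F ≤ 2‖X − Y‖_F + ‖A·Y − Y·A‖_F`. [folklore] -/
theorem frobNorm_comm_le_of_near (A X Y : SU2) :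
    frobNorm (((A * X : SU2) : Matrix (Fin 2) (Fin 2) ℂ) - ((X * A : SU2) : Matrix (Fin 2) (Fin 2) ℂ)) ≤
      2 * frobNorm ((X : Matrix (Fin 2) (Fin 2) ℂ) - (Y : Matrix (Fin 2) (Fin 2) ℂ)) +
        frobNorm (((A * Y : SU2) : Matrix (Fin 2) (Fin 2) ℂ) - ((Y * A : SU2) : Matrix (Fin 2) (Fin 2) ℂ)) := by
  have h1 : frobNorm (((A * X : SU2) : Matrix (Fin 2) (Fin 2) ℂ) - ((A * Y : SU2) : Matrix (Fin 2) (Fin 2) ℂ)) =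
      frobNorm ((X : Matrix (Fin 2) (Fin 2) ℂ) - (Y : Matrix (Fin 2) (Fin 2) ℂ)) := by
    have e : ((A * X : SU2) : Matrix (Fin 2) (Fin 2) ℂ) - ((A * Y : SU2) : Matrix (Fin 2) (Fin 2) ℂ) =
        (A : Matrix (Fin 2) (Fin 2) ℂ) * ((X : Matrix (Fin 2) (Fin 2) ℂ) - (Y : Matrix (Fin 2) (Fin 2) ℂ)) := by
      rw [Matrix.mul_sub, ← Submonoid.coe_mul, ← Submonoid.coe_mul]
    rw [e, frobNorm_unitary_mul (su2_mem_unitaryGroup _)]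
  have h2 : frobNorm (((Y * A : SU2) : Matrix (Fin 2) (Fin 2) ℂ) - ((X * A : SU2) : Matrix (Fin 2) (Fin 2) ℂ)) =
      frobNorm ((X : Matrix (Fin 2) (Fin 2) ℂ) - (Y : Matrix (Fin 2) (Fin 2) ℂ)) := by
    have e : ((Y * A : SU2) : Matrix (Fin 2) (Fin 2) ℂ) - ((X * A : SU2) : Matrix (Fin 2) (Fin 2) ℂ) =
        ((Y : Matrix (Fin 2) (Fin 2) ℂ) - (X : Matrix (Fin 2) (Fin 2) ℂ)) * (A : Matrix (Fin 2) (Fin 2) ℂ) := by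
      rw [Matrix.sub_mul, ← Submonoid.coe_mul, ← Submonoid.coe_mul]
    rw [e, frobNorm_mul_unitary _ (su2_mem_unitaryGroup _), frobNorm_sub_comm]
  calc frobNorm (((A * X : SU2) : Matrix (Fin 2) (Fin 2) ℂ) - ((X * A : SU2) : Matrix (Fin 2) (Fin 2) ℂ))
      ≤ frobNorm (((A * X : SU2) : Matrix (Fin 2) (Fin 2) ℂ) - ((A * Y : SU2) : Matrix (Fin 2) (Fin 2) ℂ)) +
          frobNorm (((A * Y : SU2) : Matrix (Fin 2) (Fin 2) ℂ) - ((X * A : SU2) : Matrix (Fin 2) (Fin 2) ℂ)) := frobNorm_sub_le _ _ _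
    _ ≤ frobNorm (((A * X : SU2) : Matrix (Fin 2) (Fin 2) ℂ) - ((A * Y : SU2) : Matrix (Fin 2) (Fin 2) ℂ)) +
          (frobNorm (((A * Y : SU2) : Matrix (Fin 2) (Fin 2) ℂ) - ((Y * A : SU2) : Matrix (Fin 2) (Fin 2) ℂ)) +
            frobNorm (((Y * A : SU2) : Matrix (Fin 2) (Fin 2) ℂ) - ((X * A : SU2) : Matrix (Fin 2) (Fin 2) ℂ))) :=
        add_le_add le_rfl (frobNorm_sub_le _ _ _)
    _ = _ := by rw [h1, h2]; ring

/-- **Slaving the fourth letter.**  If `C₀, C₂, c` pairwise commute up to `r` (Frobenius) and `C₁ = (c⁻¹C₀c)·e` with `‖e − 1‖_F ≤ r`, then the quadruple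
`(C₀, C₁, C₂, c)` is σ-twisted nearly commuting at radius `5r`: `‖C_μC_ν − C_νC_μ‖ ≤ 5r` (`μ, ν < 3`) and `‖c·C_{σμ} − C_μ·c‖ ≤ 5r`
(`cC₁ − C₀c = C₀c(e − 1)`, `‖C₁ − C₀‖ ≤ 2r`). [folklore] -/
theorem swapComm_of_slaved {r : ℝ} (hr : 0 ≤ r) (C : Fin 4 → SU2)
    (h02 : frobNorm (((C 0 * C 2 : SU2) : Matrix (Fin 2) (Fin 2) ℂ) - ((C 2 * C 0 : SU2) : Matrix (Fin 2) (Fin 2) ℂ)) ≤ r)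
    (h03 : frobNorm (((C 0 * C 3 : SU2) : Matrix (Fin 2) (Fin 2) ℂ) - ((C 3 * C 0 : SU2) : Matrix (Fin 2) (Fin 2) ℂ)) ≤ r)
    (h23 : frobNorm (((C 2 * C 3 : SU2) : Matrix (Fin 2) (Fin 2) ℂ) - ((C 3 * C 2 : SU2) : Matrix (Fin 2) (Fin 2) ℂ)) ≤ r)
    (he : frobNorm (((((C 3)⁻¹ * C 0 * C 3)⁻¹ * C 1 : SU2) : Matrix (Fin 2) (Fin 2) ℂ) - 1) ≤ r) :
    (∀ μ ν : Fin 3, frobNorm (((C (Fin.castSucc μ) * C (Fin.castSucc ν) : SU2) : Matrix (Fin 2) (Fin 2) ℂ) -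
        ((C (Fin.castSucc ν) * C (Fin.castSucc μ) : SU2) : Matrix (Fin 2) (Fin 2) ℂ)) ≤ 5 * r) ∧
      ∀ μ : Fin 3, frobNorm (((C (Fin.last 3) * C (Fin.castSucc (Equiv.swap (0 : Fin 3) 1 μ)) : SU2) : Matrix (Fin 2) (Fin 2) ℂ) -
        ((C (Fin.castSucc μ) * C (Fin.last 3) : SU2) : Matrix (Fin 2) (Fin 2) ℂ)) ≤ 5 * r := by
  set c : SU2 := C 3 with hc
  set k : SU2 := c⁻¹ * C 0 * c with hk
  -- `‖k − C₀‖ ≤ r` and `‖C₁ − C₀‖ ≤ 2r`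
  have hkC0 : frobNorm ((k : Matrix (Fin 2) (Fin 2) ℂ) - (C 0 : Matrix (Fin 2) (Fin 2) ℂ)) ≤ r := by
    have e : (k : Matrix (Fin 2) (Fin 2) ℂ) - (C 0 : Matrix (Fin 2) (Fin 2) ℂ) =
        ((c⁻¹ : SU2) : Matrix (Fin 2) (Fin 2) ℂ) * (((C 0 * c : SU2) : Matrix (Fin 2) (Fin 2) ℂ) - ((c * C 0 : SU2) : Matrix (Fin 2) (Fin 2) ℂ)) := by
      rw [Matrix.mul_sub, ← Submonoid.coe_mul, ← Submonoid.coe_mul, inv_mul_cancel_left, hk, mul_assoc]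
    rw [e, frobNorm_unitary_mul (su2_mem_unitaryGroup _)]; exact h03
  have hC1k : frobNorm ((C 1 : Matrix (Fin 2) (Fin 2) ℂ) - (k : Matrix (Fin 2) (Fin 2) ℂ)) ≤ r := by
    rw [← frobNorm_inv_mul_sub_one]; exact he
  have hC10 : frobNorm ((C 1 : Matrix (Fin 2) (Fin 2) ℂ) - (C 0 : Matrix (Fin 2) (Fin 2) ℂ)) ≤ 2 * r :=
    (frobNorm_sub_le _ _ _).trans (by linarith [hC1k, hkC0])
  -- commutators among `C₀, C₁, C₂`
  have h01 : frobNorm (((C 0 * C 1 : SU2) : Matrix (Fin 2) (Fin 2) ℂ) - ((C 1 * C 0 : SU2) : Matrix (Fin 2) (Fin 2) ℂ)) ≤ 4 * r := by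
    have h := frobNorm_comm_le_of_near (C 0) (C 1) (C 0)
    rw [sub_self, frobNorm_zero] at h
    linarith [hC10]
  have h21 : frobNorm (((C 2 * C 1 : SU2) : Matrix (Fin 2) (Fin 2) ℂ) - ((C 1 * C 2 : SU2) : Matrix (Fin 2) (Fin 2) ℂ)) ≤ 5 * r := by
    have h := frobNorm_comm_le_of_near (C 2) (C 1) (C 0)
    rw [frobNorm_sub_comm ((C 2 * C 0 : SU2) : Matrix (Fin 2) (Fin 2) ℂ)] at h
    linarith [hC10, h02]
  -- the twisted intertwinings
  have hs1 : frobNorm (((c * C 1 : SU2) : Matrix (Fin 2) (Fin 2) ℂ) - ((C 0 * c : SU2) : Matrix (Fin 2) (Fin 2) ℂ)) ≤ r := by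
    -- `c C₁ = (C₀ c) · e` with `e = k⁻¹ C₁`
    have e1 : (c * C 1 : SU2) = C 0 * c * (k⁻¹ * C 1) := by rw [hk]; group
    have e2 : frobNorm (((c * C 1 : SU2) : Matrix (Fin 2) (Fin 2) ℂ) - ((C 0 * c : SU2) : Matrix (Fin 2) (Fin 2) ℂ)) =
        frobNorm ((((k⁻¹ * C 1 : SU2)) : Matrix (Fin 2) (Fin 2) ℂ) - 1) := by
      rw [e1, ← frobNorm_inv_mul_sub_one (C 0 * c) (C 0 * c * (k⁻¹ * C 1))]
      congr 2; group
    rw [e2]; exact he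
  have hs0 : frobNorm (((c * C 0 : SU2) : Matrix (Fin 2) (Fin 2) ℂ) - ((C 1 * c : SU2) : Matrix (Fin 2) (Fin 2) ℂ)) ≤ 3 * r := by
    have hA : frobNorm (((c * C 0 : SU2) : Matrix (Fin 2) (Fin 2) ℂ) - ((C 0 * c : SU2) : Matrix (Fin 2) (Fin 2) ℂ)) ≤ r := by
      rw [frobNorm_sub_comm]; exact h03
    have hB : frobNorm (((C 0 * c : SU2) : Matrix (Fin 2) (Fin 2) ℂ) - ((C 1 * c : SU2) : Matrix (Fin 2) (Fin 2) ℂ)) ≤ 2 * r := by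
      have e : ((C 0 * c : SU2) : Matrix (Fin 2) (Fin 2) ℂ) - ((C 1 * c : SU2) : Matrix (Fin 2) (Fin 2) ℂ) =
          ((C 0 : Matrix (Fin 2) (Fin 2) ℂ) - (C 1 : Matrix (Fin 2) (Fin 2) ℂ)) * (c : Matrix (Fin 2) (Fin 2) ℂ) := by
        rw [Matrix.sub_mul, ← Submonoid.coe_mul, ← Submonoid.coe_mul]
      rw [e, frobNorm_mul_unitary _ (su2_mem_unitaryGroup _), frobNorm_sub_comm]; exact hC10
    exact (frobNorm_sub_le _ _ _).trans (by linarith)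
  have hs2 : frobNorm (((c * C 2 : SU2) : Matrix (Fin 2) (Fin 2) ℂ) - ((C 2 * c : SU2) : Matrix (Fin 2) (Fin 2) ℂ)) ≤ r := by
    rw [frobNorm_sub_comm]; exact h23
  have h00 : ∀ a : Fin 4, frobNorm (((C a * C a : SU2) : Matrix (Fin 2) (Fin 2) ℂ) - ((C a * C a : SU2) : Matrix (Fin 2) (Fin 2) ℂ)) ≤ 5 * r :=
    fun a => by rw [sub_self, frobNorm_zero]; linarith
  have h10 : frobNorm (((C 1 * C 0 : SU2) : Matrix (Fin 2) (Fin 2) ℂ) - ((C 0 * C 1 : SU2) : Matrix (Fin 2) (Fin 2) ℂ)) ≤ 4 * r := by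
    rw [frobNorm_sub_comm]; exact h01
  have h20 : frobNorm (((C 2 * C 0 : SU2) : Matrix (Fin 2) (Fin 2) ℂ) - ((C 0 * C 2 : SU2) : Matrix (Fin 2) (Fin 2) ℂ)) ≤ r := by
    rw [frobNorm_sub_comm]; exact h02
  have h12 : frobNorm (((C 1 * C 2 : SU2) : Matrix (Fin 2) (Fin 2) ℂ) - ((C 2 * C 1 : SU2) : Matrix (Fin 2) (Fin 2) ℂ)) ≤ 5 * r := by
    rw [frobNorm_sub_comm]; exact h21
  have key : ∀ a b : Fin 4, (a = 0 ∨ a = 1 ∨ a = 2) → (b = 0 ∨ b = 1 ∨ b = 2) →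
      frobNorm (((C a * C b : SU2) : Matrix (Fin 2) (Fin 2) ℂ) - ((C b * C a : SU2) : Matrix (Fin 2) (Fin 2) ℂ)) ≤ 5 * r := by
    rintro a b (rfl | rfl | rfl) (rfl | rfl | rfl)
    · exact h00 0
    · linarith [h01]
    · linarith [h02]
    · linarith [h10]
    · exact h00 1
    · exact h12
    · linarith [h20]
    · exact h21
    · exact h00 2
  refine ⟨fun μ ν => key _ _ (by fin_cases μ <;> decide) (by fin_cases ν <;> decide), fun μ => ?_⟩
  fin_cases μ
  · show frobNorm (((C (Fin.last 3) * C (Fin.castSucc (Equiv.swap (0 : Fin 3) 1 0)) : SU2) : Matrix (Fin 2) (Fin 2) ℂ) -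
        ((C (Fin.castSucc 0) * C (Fin.last 3) : SU2) : Matrix (Fin 2) (Fin 2) ℂ)) ≤ 5 * r
    rw [Equiv.swap_apply_left]
    show frobNorm (((c * C 1 : SU2) : Matrix (Fin 2) (Fin 2) ℂ) - ((C 0 * c : SU2) : Matrix (Fin 2) (Fin 2) ℂ)) ≤ 5 * r
    linarith [hs1]
  · show frobNorm (((C (Fin.last 3) * C (Fin.castSucc (Equiv.swap (0 : Fin 3) 1 1)) : SU2) : Matrix (Fin 2) (Fin 2) ℂ) -
        ((C (Fin.castSucc 1) * C (Fin.last 3) : SU2) : Matrix (Fin 2) (Fin 2) ℂ)) ≤ 5 * r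
    rw [Equiv.swap_apply_right]
    show frobNorm (((c * C 0 : SU2) : Matrix (Fin 2) (Fin 2) ℂ) - ((C 1 * c : SU2) : Matrix (Fin 2) (Fin 2) ℂ)) ≤ 5 * r
    linarith [hs0]
  · show frobNorm (((C (Fin.last 3) * C (Fin.castSucc (Equiv.swap (0 : Fin 3) 1 2)) : SU2) : Matrix (Fin 2) (Fin 2) ℂ) -
        ((C (Fin.castSucc 2) * C (Fin.last 3) : SU2) : Matrix (Fin 2) (Fin 2) ℂ)) ≤ 5 * r
    rw [Equiv.swap_apply_of_ne_of_ne (by decide) (by decide)]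
    show frobNorm (((c * C 2 : SU2) : Matrix (Fin 2) (Fin 2) ℂ) - ((C 2 * c : SU2) : Matrix (Fin 2) (Fin 2) ℂ)) ≤ 5 * r
    linarith [hs2]


/-! ## §2 The σ-twisted leader volume from a three-letter volume bound -/

/-- ★★ **σ-TWISTED LEADER VOLUME FROM A THREE-LETTER VOLUME.**  If the Haar³-volume of the triples `D : Fin 3 → SU(2)` with pairwise Frobenius
commutators `≤ t` is at least `c·t⁴` for `0 < t ≤ t₀` (the swap-central cone of commuting triples — pole `2`, no logarithm), then for `0 < s ≤ 5t₀`, `s ≤ 10`,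
the Haar⁴-volume of the σ-twisted nearly-commuting quadruples of radius `s` is at least `(c/34/5⁷)·s⁷`: the quadruples with `(C₀, C₂, c)` nearly commuting at
radius `s/5` and `C₁` in the ball of radius `s/5` about `c⁻¹C₀c` qualify (`swapComm_of_slaved`), and that set is the preimage of a product under the
product-Haar preserving map `C ↦ ((c⁻¹C₀c)⁻¹C₁, (C₀, C₂, c))` (`piFinSuccAbove` at the index `1`, then a skew translation of the removed coordinate).
[cite: Luscher1983, §2] [cite: GonzalezarroyoAltes1988] -/
theorem swapCommVolume_of_threeLetterVolume {c t₀ : ℝ} (hc : 0 ≤ c)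
    (hvol3 : ∀ t : ℝ, 0 < t → t ≤ t₀ → c * t ^ 4 ≤
      (Measure.pi fun _ : Fin 3 => haarProbability SU2).real
        {D : Fin 3 → SU2 | ∀ μ ν : Fin 3,
          frobNorm (((D μ * D ν : SU2) : Matrix (Fin 2) (Fin 2) ℂ) - ((D ν * D μ : SU2) : Matrix (Fin 2) (Fin 2) ℂ)) ≤ t})
    {s : ℝ} (hs0 : 0 < s) (hs : s ≤ 5 * t₀) (hs10 : s ≤ 10) :
    c / 34 / 5 ^ 7 * s ^ 7 ≤ (Measure.pi fun _ : Fin 4 => haarProbability SU2).real {C : Fin 4 → SU2 |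
      (∀ μ ν : Fin 3, frobNorm (((C (Fin.castSucc μ) * C (Fin.castSucc ν) : SU2) : Matrix (Fin 2) (Fin 2) ℂ) -
        ((C (Fin.castSucc ν) * C (Fin.castSucc μ) : SU2) : Matrix (Fin 2) (Fin 2) ℂ)) ≤ s) ∧
      ∀ μ : Fin 3, frobNorm (((C (Fin.last 3) * C (Fin.castSucc (Equiv.swap (0 : Fin 3) 1 μ)) : SU2) : Matrix (Fin 2) (Fin 2) ℂ) -
        ((C (Fin.castSucc μ) * C (Fin.last 3) : SU2) : Matrix (Fin 2) (Fin 2) ℂ)) ≤ s} := by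
  haveI : (haarProbability SU2).IsMulLeftInvariant := by unfold haarProbability; infer_instance
  set r : ℝ := s / 5 with hr
  have hr0 : 0 < r := by rw [hr]; positivity
  have hrt : r ≤ t₀ := by rw [hr, div_le_iff₀ (by norm_num)]; linarith
  have hr2 : r ≤ 2 := by rw [hr, div_le_iff₀ (by norm_num)]; linarith
  have hsr : s = 5 * r := by rw [hr]; ring
  set π4 : Measure (Fin 4 → SU2) := Measure.pi fun _ : Fin 4 => haarProbability SU2 with hπ4
  set π3 : Measure (Fin 3 → SU2) := Measure.pi fun _ : Fin 3 => haarProbability SU2 with hπ3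
  -- the straightening map `Λ C = ((c⁻¹C₀c)⁻¹·C₁, (C₀, C₂, c))`
  set κ : (Fin 3 → SU2) → SU2 := fun D => ((D 2)⁻¹ * D 0 * D 2)⁻¹ with hκ
  have hκm : Measurable κ :=
    (((measurable_pi_apply 2).inv.mul (measurable_pi_apply 0)).mul (measurable_pi_apply 2)).inv
  set e4 := MeasurableEquiv.piFinSuccAbove (fun _ : Fin 4 => SU2) 1 with he4
  have h4 : MeasurePreserving e4 π4 ((haarProbability SU2).prod π3) :=
    measurePreserving_piFinSuccAbove (fun _ : Fin 4 => haarProbability SU2) 1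
  set sk : (Fin 3 → SU2) × SU2 → (Fin 3 → SU2) × SU2 := fun p => (id p.1, κ p.1 * p.2) with hsk
  have hskm : MeasurePreserving sk (π3.prod (haarProbability SU2)) (π3.prod (haarProbability SU2)) :=
    (MeasurePreserving.id π3).skew_product ((hκm.comp measurable_fst).mul measurable_snd)
      (ae_of_all _ fun D => (measurePreserving_mul_left (haarProbability SU2) (κ D)).map_eq)
  set Λ : (Fin 4 → SU2) → SU2 × (Fin 3 → SU2) := fun C => Prod.swap (sk (Prod.swap (e4 C))) with hΛ
  have hΛ : MeasurePreserving Λ π4 ((haarProbability SU2).prod π3) :=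
    (Measure.measurePreserving_swap.comp (hskm.comp Measure.measurePreserving_swap)).comp h4
  have hΛ_fst : ∀ C : Fin 4 → SU2, (Λ C).1 = ((C 3)⁻¹ * C 0 * C 3)⁻¹ * C 1 := by
    intro C
    rfl
  have hΛ_snd : ∀ (C : Fin 4 → SU2) (j : Fin 3), (Λ C).2 j = C (Fin.succAbove 1 j) := by
    intro C j
    rfl
  -- the product target
  set B : Set SU2 := {W : SU2 | frobNorm ((W : Matrix (Fin 2) (Fin 2) ℂ) - 1) ≤ r} with hB
  set T : Set (Fin 3 → SU2) := {D : Fin 3 → SU2 | ∀ μ ν : Fin 3,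
    frobNorm (((D μ * D ν : SU2) : Matrix (Fin 2) (Fin 2) ℂ) - ((D ν * D μ : SU2) : Matrix (Fin 2) (Fin 2) ℂ)) ≤ r} with hT
  have hBm : MeasurableSet B := measurableSet_frobBall_one r
  have hTm : MeasurableSet T := by
    have e : T = ⋂ μ : Fin 3, ⋂ ν : Fin 3, {D : Fin 3 → SU2 |
        frobNorm (((D μ * D ν : SU2) : Matrix (Fin 2) (Fin 2) ℂ) - ((D ν * D μ : SU2) : Matrix (Fin 2) (Fin 2) ℂ)) ≤ r} := by
      ext D; simp only [hT, Set.mem_setOf_eq, Set.mem_iInter]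
    rw [e]
    refine MeasurableSet.iInter fun μ => MeasurableSet.iInter fun ν => (isClosed_le ?_ continuous_const).measurableSet
    refine continuous_frobNorm'.comp ?_
    exact (continuous_subtype_val.comp ((continuous_apply μ).mul (continuous_apply ν))).sub
      (continuous_subtype_val.comp ((continuous_apply ν).mul (continuous_apply μ)))
  -- the preimage qualifies
  have hsub : Λ ⁻¹' (B ×ˢ T) ⊆ {C : Fin 4 → SU2 |
      (∀ μ ν : Fin 3, frobNorm (((C (Fin.castSucc μ) * C (Fin.castSucc ν) : SU2) : Matrix (Fin 2) (Fin 2) ℂ) -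
        ((C (Fin.castSucc ν) * C (Fin.castSucc μ) : SU2) : Matrix (Fin 2) (Fin 2) ℂ)) ≤ s) ∧
      ∀ μ : Fin 3, frobNorm (((C (Fin.last 3) * C (Fin.castSucc (Equiv.swap (0 : Fin 3) 1 μ)) : SU2) : Matrix (Fin 2) (Fin 2) ℂ) -
        ((C (Fin.castSucc μ) * C (Fin.last 3) : SU2) : Matrix (Fin 2) (Fin 2) ℂ)) ≤ s} := by
    intro C hC
    rw [Set.mem_preimage, Set.mem_prod] at hC
    obtain ⟨hCB, hCT⟩ := hC
    rw [hΛ_fst] at hCB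
    have hT' : ∀ j j' : Fin 3, frobNorm (((C (Fin.succAbove 1 j) * C (Fin.succAbove 1 j') : SU2) : Matrix (Fin 2) (Fin 2) ℂ) -
        ((C (Fin.succAbove 1 j') * C (Fin.succAbove 1 j) : SU2) : Matrix (Fin 2) (Fin 2) ℂ)) ≤ r := fun j j' => by
      have h := hCT j j'
      rwa [hΛ_snd, hΛ_snd] at h
    rw [hsr]
    exact swapComm_of_slaved hr0.le C (hT' 0 1) (hT' 0 2) (hT' 1 2) hCB
  -- volumes
  haveI : IsProbabilityMeasure π4 := by rw [hπ4]; infer_instance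
  have hvol : π4.real (Λ ⁻¹' (B ×ˢ T)) = ballVol r * π3.real T := by
    rw [measureReal_def, hΛ.measure_preimage (hBm.prod hTm).nullMeasurableSet, Measure.prod_prod, ENNReal.toReal_mul]
    rfl
  have hb : r ^ 3 / 34 ≤ ballVol r := pow_three_div_le_ballVol hr0.le hr2
  have hv3 := hvol3 r hr0 hrt
  calc c / 34 / 5 ^ 7 * s ^ 7 = (r ^ 3 / 34) * (c * r ^ 4) := by rw [hsr]; ring
    _ ≤ ballVol r * π3.real T := mul_le_mul hb hv3 (by positivity) (ballVol_nonneg _)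
    _ = π4.real (Λ ⁻¹' (B ×ˢ T)) := hvol.symm
    _ ≤ _ := measureReal_mono hsub (measure_ne_top _ _)

end Summit.QuantumFields.YangMills.Theorems.SwapVirialDeficit.SwapRing

end
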